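import Summits.QuantumFields.BalabanUV.T4Continuum.Spine.NE3.PairLandauB8
import Literature.MathematicalPhysics.QuantumFieldTheory.Balaban1983to89.B7Eq214GeneralQprime
import HarnessLib

/-!
# T⁴ programme, node NE3 (pub-ymgap DAG node N16) — THE TEST SPACE OF (1.38) IS THE KERNEL OF THE DECL-OF-RECORD `Q′_k`:
# `NE3CovariantBlockMean.bmeanIterW L k W = B7Eq214General.lamAvgG L W k = B7Eq78Linearization.QprimeIter (zdBlocking d L) (transp L W) k`,
# hence `PairLandauB8.avgKernelGauges L N k W = {μ skew, (N·Lᵏ)-periodic | Q′_k(W)μ = 0}` — B8 p. 80 «N(Q′(U₀)) = {λ : Q′(U₀)λ = 0}» BY NAME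
# (`AvgKernelQprimeB8`)

Cell `pub-ymgap`, HUMAN RULING D-0062, seat `pub-ymgap-dag-n16-b` (FIRST-MISSING-ESTIMATE for N16 = NE3; writer prover-pub-ymgap-dag-n16-b-g2-0,
2026-08-26).  Companion of `Spine/NE3/PairLandauB8` (THE END's (1.38) `IsLandauB8 L N k W Z`: `Z ⊥ gaugeDir W (Δ_W μ)` for all
`μ ∈ avgKernelGauges L N k W`, the Spine's reading (R-d) of B8's `N(Q′(W))` through K0a's nested transported block mean `bmeanIterW`) and of
`Spine/NE3/PairLeftChartB8` (the left-chart ↔ END-frame dictionary).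

WHY.  [Balaban1985RegularSpaces] p. 80: «We consider the subspace N(Q′(U₀)) = {λ : Q′(U₀)λ = 0} … An operator R(U₀) is defined as an
orthogonal projection … onto the subspace Δ^η_{U₀}N(Q′(U₀))», (1.38) «R(U₀)D^{η*}_{U₀}A = 0»; «a linear part of the function (1/i) log(R₀u_j)(y)
is equal to (Q′_j(U₀)λ)(y)».  The operator `Q′_j(U₀)` IS typed in the tree on the ℤᵈ carrier — lit-balaban row B7.Eq212's decl of record
`B7Eq78Linearization.QprimeIter` ([Balaban1985Averaging] (212) p. 50 = [Balaban1985BackgroundPropagators] (3.19)), with the concrete kernel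
`B7Eq214General.lamAvgG` and the bridge `B7Eq214GeneralQprime.lamAvgG_eq_QprimeIter`, AND its linearisation statement (213)–(214)
(`B7Eq214GeneralQprime.eq214_general_QprimeIter`: `‖log ũ′ʲ(z) − Q′_jλ(z)‖ ≤ C′(α₃α₄ + α₄²)LʲL^{−k}`).  THE END's test space was typed
independently (`NE3CovariantBlockMean.bmeanIterW`, pub-balaban-gaps ne3).  This file proves the two objects are THE SAME FUNCTION — so node N05's
`R(U₀)` (to be built on `ker Q′_k(U₀)`, n05-a's §8) and THE END's `avgKernelGauges` speak about one kernel, and the (1.38) dictionary reduces to the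
summation by parts already named in `PairLandauB8` (R-d).

WHAT ([folklore]; 0 def, 0 sorry): `bmeanW_eq_rlam` (one transported block mean = (211)'s `rlam` at the block corner `L•z`, definitional);
`lamAvgG_succ_left` (the «first step first» recursion of `Q′_{j+1}`: `Q′_{j+1}(W) = Q′_j(W̄) ∘ Q′₁(W)`, `W̄ = cavg L W`, by `MinimalActionLevels.avgIter_rescale_bavg`);
**`bmeanIterW_eq_lamAvgG`**, **`bmeanIterW_eq_QprimeIter`**; **`mem_avgKernelGauges_iff`** — `μ ∈ avgKernelGauges L N k W ↔ μ` skew ∧ `(N·Lᵏ)`-periodic ∧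
`∀ z, QprimeIter (zdBlocking d L) (transp L W) k μ z = 0`.
HONEST FRAMING (page 1): a dictionary between two tree vocabularies; nothing estimated; (1.38) for Bałaban's minimisers is N05's ([B8] Thm 4, NOT
proved); `R(U₀)` itself (the orthogonal projection) is not an object of this file; Thm 2 ∕ NE3 NOT proved; spine 0∕9; finite T⁴ rung (B)+1 at fixed ε —
NOT infinite volume, NOT mass gap, NOT `BetaPertH`, NOT Clay.  PLACEMENT: `Spine/NE3/`.
-/

set_option autoImplicit false

open scoped BigOperators Matrix Matrix.Norms.L2Operator
open NormedSpace

namespace Summit.QuantumFields.BalabanUV.T4Continuum.NE3.AvgKernelQprimeB8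

open Literature.MathematicalPhysics.QuantumFieldTheory.Balaban1983to89
open B7Prop1Explicit B7Prop2Explicit
open B7Eq214General (lamAvgG rlam lamAvgG_zero)
open B7Eq214GeneralQprime (transp lamAvgG_eq_QprimeIter)
open B7Eq78Linearization (QprimeIter zdBlocking)
open T4AveragingDeficitWall (Ad)
open AveragingDeficitChartCalculus (cavg)
open AveragingDeficitMultiLevelBridge (cavg_eq_rescale_bavg)
open MinimalActionLevels (avgIter_rescale_bavg)
open NE3CovariantBlockMean (bmeanW bmeanIterW bmeanIterW_succ)
open NE3.PairLandauB8 (avgKernelGauges)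

noncomputable section

variable {d : ℕ} {n : Type*} [Fintype n] [DecidableEq n]

/-- **ONE TRANSPORTED BLOCK MEAN IS (211)'s `rlam` AT THE BLOCK CORNER**: `bmeanW L W μ z = rlam L W μ (L•z)` (both are
`Σ_{r∈[0,L)^d} L^{−d}·R(W(Γ_{L•z, L•z+r}))μ(L•z + r)`; `Ad = cj`). [folklore] -/
theorem bmeanW_eq_rlam (L : ℕ) (W : Site d → Fin d → (Matrix n n ℂ)ˣ) (mu : Site d → Matrix n n ℂ) (z : Site d) :
    bmeanW L W mu z = rlam L W mu ((L : ℤ) • z) := rfl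

/-- **THE «FIRST STEP FIRST» RECURSION OF `Q′_{j+1}`**: `Q′_{j+1}(W)f = Q′_j(W̄)(Q′₁(W)f)`, `W̄ = cavg L W` — (77)–(78): the composed transport
through `j+1` levels is one step at `W` followed by `j` steps at the averaged backgrounds of `W̄` (`avgIter L W̄ j = avgIter L W (j+1)`,
`MinimalActionLevels.avgIter_rescale_bavg`). [folklore] -/
theorem lamAvgG_succ_left (L : ℕ) : ∀ (j : ℕ) (W : Site d → Fin d → (Matrix n n ℂ)ˣ) (f : Site d → Matrix n n ℂ),
    lamAvgG L W (j + 1) f = lamAvgG L (cavg L W) j (fun z => rlam L W f ((L : ℤ) • z))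
  | 0, W, f => by
    funext z
    rfl
  | j + 1, W, f => by
    funext z
    show rlam L (avgIter L W (j + 1)) (lamAvgG L W (j + 1) f) ((L : ℤ) • z) =
      rlam L (avgIter L (cavg L W) j) (lamAvgG L (cavg L W) j (fun z => rlam L W f ((L : ℤ) • z))) ((L : ℤ) • z)
    rw [lamAvgG_succ_left L j W f, cavg_eq_rescale_bavg, avgIter_rescale_bavg]

/-- **THE END's NESTED TRANSPORTED BLOCK MEAN IS lit-balaban's `Q′_k`**: `bmeanIterW L k W μ = lamAvgG L W k μ` for every background `W`
and every site field `μ`. [folklore] -/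
theorem bmeanIterW_eq_lamAvgG (L : ℕ) : ∀ (k : ℕ) (W : Site d → Fin d → (Matrix n n ℂ)ˣ) (mu : Site d → Matrix n n ℂ),
    bmeanIterW L k W mu = lamAvgG L W k mu
  | 0, W, mu => rfl
  | k + 1, W, mu => by
    rw [bmeanIterW_succ, bmeanIterW_eq_lamAvgG L k, lamAvgG_succ_left]
    rfl

/-- **… AND HENCE THE DECL OF RECORD `QprimeIter`** (row B7.Eq212 ∕ B9 (3.19)): `bmeanIterW L k W μ z = QprimeIter (zdBlocking d L) (transp L W) k μ z`.
[folklore] -/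
theorem bmeanIterW_eq_QprimeIter (L k : ℕ) (W : Site d → Fin d → (Matrix n n ℂ)ˣ) (mu : Site d → Matrix n n ℂ) (z : Site d) :
    bmeanIterW L k W mu z = QprimeIter (zdBlocking d L) (transp L W) k mu z := by
  rw [bmeanIterW_eq_lamAvgG, lamAvgG_eq_QprimeIter]

/-- **`N(Q′(W))` BY NAME**: the test space of THE END's (1.38) (`PairLandauB8.avgKernelGauges`) is the set of skew, `(N·Lᵏ)`-periodic site
fields in the kernel of the decl-of-record `Q′_k(W)` — B8 p. 80 «N(Q′(U₀)) = {λ : Q′(U₀)λ = 0}» in the all-small-field reading (R-a)∕(R-d).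
[folklore] -/
theorem mem_avgKernelGauges_iff {L N k : ℕ} {W : Site d → Fin d → (Matrix n n ℂ)ˣ} {mu : Site d → Matrix n n ℂ} :
    mu ∈ avgKernelGauges (d := d) (n := n) L N k W ↔
      (∀ y : Site d, mu y ∈ skewAdjoint (Matrix n n ℂ)) ∧
      (∀ (y : Site d) (i : Fin d), mu (y + ((N * L ^ k : ℕ) : ℤ) • e i) = mu y) ∧
      ∀ z : Site d, QprimeIter (zdBlocking d L) (transp L W) k mu z = 0 := by
  rw [NE3.PairLandauB8.mem_avgKernelGauges_iff]
  refine and_congr Iff.rfl (and_congr Iff.rfl ?_)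
  constructor
  · intro h z
    rw [← bmeanIterW_eq_QprimeIter, h]
    rfl
  · intro h
    funext z
    rw [bmeanIterW_eq_QprimeIter]
    exact h z

end

end Summit.QuantumFields.BalabanUV.T4Continuum.NE3.AvgKernelQprimeB8
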